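import Literature.ComputerArithmetic.BrentZimmermann2010.BesselGeneratingFunction
import HarnessLib

/-!
# Route `PrimeLevelFamEdge`, crux K_B (stmt-Parity-20343), line `diagonal_kernel_split` rev 4, plan Ω,
# lemma L2c (derivative costs), primitive 1: **all derivatives of the Bessel functions `J_n` are bounded by `1`**

OMEGA-BLUEPRINT §2–§3 L2: the dual lengths `H_j` come from `k`-fold partial integration of the box weights
`Φ_i = θ(y₁/K₁)θ(y₂/K₂)·g`, `g ∝ W(·)·J₁(Z√(·))`; every `∂_{y_j}` falling on the Bessel factor produces derivatives
`J₁^{(i)}`. This file proves the primitive `|J_n^{(i)}(x)| ≤ 1` for all `n, i ∈ ℕ`, `x ∈ ℝ`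
(`abs_iteratedDeriv_besselJ_le_one`), by induction on `i` from the tree's `J_0' = −J_1`,
`J_{n+1}' = (J_n − J_{n+2})/2` (`BrentZimmermann2010.BesselGeneratingFunction.deriv_besselJ_zero/succ`,
from `hasDerivAt_besselJ_zero_holds` / `hasDerivAt_besselJ_succ_everywhere`) and `|J_n| ≤ 1`
(`abs_besselJ_le_one_holds`); plus the scaled form `|dⁱ/dsⁱ J_n(bs)| ≤ |b|ⁱ`
(`abs_iteratedDeriv_besselJ_comp_mul_le`). Folklore (DLMF 10.6.1, 10.14.1), PROVED; theorems only.
«The programme SEARCHES and TYPES; no claim about Landau–Siegel zeros, Theorems 1–2 of arXiv:2211.02515 or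
a repaired Margin232 until a kernel theorem says so.»
-/

noncomputable section

open Real

namespace Summit.Parity.GeneralizedHardyLittlewood.Theorems.BeyondDiagonalBeatsQuarter.OffDiagPoissonTwisted

open Literature.Analysis.FunctionSpaces
open Literature.ComputerArithmetic.BrentZimmermann2010.BesselGeneratingFunction (deriv_besselJ_zero
  deriv_besselJ_succ)

/-- `J_n` is `C^i` at every point (from the tree's `contDiff_besselJ_holds`). [folklore] -/
theorem contDiffAt_besselJ (n i : ℕ) (x : ℝ) : ContDiffAt ℝ i (besselJ n) x :=
  (contDiff_besselJ_holds n).contDiffAt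

/-- **All derivatives of all `J_n` are bounded by `1`**: `|J_n^{(i)}(x)| ≤ 1` for `n, i ∈ ℕ`, `x ∈ ℝ`
(each differentiation replaces `J_m` by `−J_1` or by an average `(J_{m−1} − J_{m+1})/2`). [folklore] -/
theorem abs_iteratedDeriv_besselJ_le_one (i n : ℕ) (x : ℝ) : |iteratedDeriv i (besselJ n) x| ≤ 1 := by
  induction i generalizing n x with
  | zero => simpa using abs_besselJ_le_one_holds n x
  | succ i ih =>
    rw [iteratedDeriv_succ']
    rcases n with _ | n
    · rw [deriv_besselJ_zero, iteratedDeriv_fun_neg, abs_neg]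
      exact ih 1 x
    · rw [deriv_besselJ_succ, iteratedDeriv_div_const,
        iteratedDeriv_fun_sub (contDiffAt_besselJ n i x) (contDiffAt_besselJ (n + 2) i x), abs_div,
        abs_two]
      have h1 := ih n x
      have h2 := ih (n + 2) x
      have h3 := abs_sub (iteratedDeriv i (besselJ n) x) (iteratedDeriv i (besselJ (n + 2)) x)
      linarith

/-- `‖J_n^{(i)}(x)‖ ≤ 1` (norm form). [folklore] -/
theorem norm_iteratedDeriv_besselJ_le_one (i n : ℕ) (x : ℝ) : ‖iteratedDeriv i (besselJ n) x‖ ≤ 1 := by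
  rw [Real.norm_eq_abs]
  exact abs_iteratedDeriv_besselJ_le_one i n x

/-- **Scaled form**: `|dⁱ/dsⁱ J_n(b·s)| ≤ |b|ⁱ` for `b ∈ ℝ`. [folklore] -/
theorem abs_iteratedDeriv_besselJ_comp_mul_le (i n : ℕ) (b x : ℝ) :
    |iteratedDeriv i (fun s => besselJ n (b * s)) x| ≤ |b| ^ i := by
  rw [iteratedDeriv_comp_const_mul (contDiff_besselJ_holds n) b]
  dsimp only
  rw [abs_mul, abs_pow]
  exact mul_le_of_le_one_right (by positivity) (abs_iteratedDeriv_besselJ_le_one i n _)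

end Summit.Parity.GeneralizedHardyLittlewood.Theorems.BeyondDiagonalBeatsQuarter.OffDiagPoissonTwisted
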